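import Literature.IUT.LogVolume.Corollary22Legendre
import Literature.NumberTheory.DiophantineGeometry.GenEllImageModLContainsSL2
import HarnessLib

/-!
# [IUTchIV] Cor. 2.2 (ii) / Thm. 1.10: "`l ≠ 5`" — at `l = 5` condition (P6) fails for the theta-field

Mochizuki, *Inter-universal Teichmüller theory IV*, RIMS manuscript (Apr. 2020; = PRIMS **57** (2021)),
Thm. 1.10, p. 22: "[Thus, it follows from Proposition 1.8, (iv), that `E_F ≅ E_{F_tpd} ×_{F_tpd} F` over `F`,
and from [IUTchI], Definition 3.1, (c), that `l ≠ 5`.]" — since the `(3·5)`-torsion points of `E_F` are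
rational over `F = F_tpd(√−1, E_{F_tpd}[3·5])`, the image of `Gal(F̄/F)` on `E_F[5]` is trivial, so it cannot
contain `SL₂(𝔽₅)`. PROOF-ONLY file (no definitions); classical; TAKES NO SIDE on [IUTchIII] Cor. 3.12.

`not_condP6_five_of_isThetaField`: for every theta-field `F` of `λ ∈ U_X` (`Cor22.IsThetaField`), the condition
`Cor22.CondP6 P 5` is false — `E_F[5](F̄) ≅ 𝔽₅²` (the tree's `card_torsionPoints_eq_sq`, via abc-iut-S-d4's
`EllPoint.finrank_geomTorsion_eq_two` / `natCard_geomTorsion_eq_sq`) carries the determinant-one automorphism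
`−1 ≠ 1`, which no Galois element induces when the `15`-torsion is fixed. Hence the case `l = 5` of the
interface `Cor22.Thm110Legendre` is vacuous as soon as a theta-field exists (abc-iut-S-d1,
`Cor22.exists_isThetaField`), which is the hypothesis `h5` of `Cor22.thm110Legendre_of_numerics`.
-/

noncomputable section

namespace Literature.IUT.LogVolume

namespace Cor22

open NumberField Literature.NumberTheory.DiophantineGeometry.GenEll Literature.NumberTheory.EllipticCurves

/-- **At `l = 5`, (P6) fails for the theta-field** (Thm. 1.10 p. 22: "`l ≠ 5`"): given a theta-field `F` of
`λ ∈ U_X`, `¬ Cor22.CondP6 P 5`. [claim: Mochizuki2012, status: disputed] -/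
theorem not_condP6_five_of_isThetaField {P : NFPoint} (hU : P.InU) (F : Type) [Field F] [NumberField F]
    [Algebra P.F F] (hF : IsThetaField P F) : ¬ CondP6 P 5 := by
  intro h6
  haveI : Fact (Nat.Prime 5) := ⟨by norm_num⟩
  haveI : NeZero (5 : ℕ) := ⟨by norm_num⟩
  have hSL : (thetaEllPoint P hU F).ImageModLContainsSL2 5 := h6 hU F hF
  set Q := thetaEllPoint P hU F with hQ
  letI : Module (ZMod 5) (Q.W.geomTorsion ((5 : ℕ) : ℤ)) := AddSubgroup.torsionBy.zmodModule
  have hdim := Q.finrank_geomTorsion_eq_two 5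
  haveI : FiniteDimensional (ZMod 5) (Q.W.geomTorsion ((5 : ℕ) : ℤ)) := .of_finrank_eq_succ hdim
  -- the determinant-one automorphism `−1`
  have hdet : LinearMap.det ((-1 : ZMod 5) • (LinearMap.id :
      Q.W.geomTorsion ((5 : ℕ) : ℤ) →ₗ[ZMod 5] Q.W.geomTorsion ((5 : ℕ) : ℤ))) = 1 := by
    rw [LinearMap.det_smul, LinearMap.det_id, hdim]
    norm_num
  obtain ⟨σ, hσ⟩ := hSL _ hdet
  -- every `5`-torsion point is fixed by `σ` (the `15`-torsion is `F`-rational) and negated by `σ`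
  have hall : ∀ x : Q.W.geomTorsion ((5 : ℕ) : ℤ), x = 0 := by
    intro x
    have h5' : ((5 : ℕ) : ℤ) • (x : Q.W.geomPoints) = 0 := (Submodule.mem_torsionBy_iff _ _).mp x.2
    have h5 : (5 : ℤ) • (x : Q.W.geomPoints) = 0 := by exact_mod_cast h5'
    have h15 : (15 : ℤ) • (x : Q.W.geomPoints) = 0 := by
      rw [show (15 : ℤ) = 3 * 5 by norm_num, mul_smul, h5, smul_zero]
    have hfix : σ • (x : Q.W.geomPoints) = x := hF.torsion_rational σ (x : Q.W.geomPoints) h15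
    have hneg : ((σ • x : Q.W.geomTorsion ((5 : ℕ) : ℤ)) : Q.W.geomPoints) = -(x : Q.W.geomPoints) := by
      rw [hσ x]
      simp
    rw [AddSubgroup.torsionBy.coe_smul, hfix] at hneg
    -- `x = −x` and `5x = 0` give `x = 0`
    have h2 : (2 : ℤ) • (x : Q.W.geomPoints) = 0 := by
      rw [two_smul]
      nth_rewrite 2 [hneg]
      exact add_neg_cancel _
    have hx : (x : Q.W.geomPoints) = 0 := by
      have e : (x : Q.W.geomPoints) =
          (5 : ℤ) • (x : Q.W.geomPoints) - (2 : ℤ) • ((2 : ℤ) • (x : Q.W.geomPoints)) := by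
        module
      rw [e, h5, h2, smul_zero, sub_zero]
    exact Subtype.ext hx
  -- but `#E[5] = 25`
  have hcard : Nat.card (Q.W.geomTorsion ((5 : ℕ) : ℤ)) = 5 ^ 2 := Q.natCard_geomTorsion_eq_sq 5
  haveI : Subsingleton (Q.W.geomTorsion ((5 : ℕ) : ℤ)) := ⟨fun a b => by rw [hall a, hall b]⟩
  have h1 : Nat.card (Q.W.geomTorsion ((5 : ℕ) : ℤ)) ≤ 1 := Finite.card_le_one_iff_subsingleton.mpr ‹_›
  omega

/-- Hence, once every `λ ∈ U_X` has a theta-field (abc-iut-S-d1, `Cor22.exists_isThetaField`, in the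
`Type`-level form), `Cor22.CondP6 P 5` never holds — the hypothesis `h5` of `Cor22.thm110Legendre_of_numerics`.
[claim: Mochizuki2012, status: disputed] -/
theorem not_condP6_five_of_exists {P : NFPoint} (hU : P.InU)
    (hex : ∃ (F : Type) (_ : Field F) (_ : NumberField F) (_ : Algebra P.F F), IsThetaField P F) :
    ¬ CondP6 P 5 := by
  obtain ⟨F, _, _, _, hF⟩ := hex
  exact not_condP6_five_of_isThetaField hU F hF

end Cor22

end Literature.IUT.LogVolume

end
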